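import Literature.NumberTheory.LFunctions.Zhang2022.RepairFormReflection
import Literature.NumberTheory.LFunctions.Zhang2022.MainTermFormProbePair

/-!
# Gluing a design's two halves: `𝔅(g₁ + R̃g₂) = 𝔅(g₁) + 𝔅(g₂) + 2 Re P(g₁, R̃g₂)` on `H¹`

Y. Zhang, *Discrete mean estimates and the Landau–Siegel zero*, arXiv:2211.02515v1 (2022)
[Zhang2022LandauSiegel] — an unrefereed manuscript under adjudication; nothing here is a claim
about its Theorems 1–2 or about Landau–Siegel zeros. Repair rung F-S1R (D-0077), structural route
(RULING R3; plan `repair/p4/Q2-ARCHITECTURE.md`), item p4-S (S3, generic part).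

In the main-term dictionary (pub-zhang `STRUCTURE.md` §§1, 4) the test vector
`𝔥 = H₁ + Z(s,χψ)H̄₂` of (2.27)/(2.32) has the GLUED profile `𝔤 = g₁ + R̃g₂` on `[0,1]`, where `g₁`
is the `H₁`-profile (supported in `[0, ν₁]`), `g₂` the `H₂`-profile (supported in `[0, ν₂]`) and
`R̃` the functional-equation reflection of `RepairFormReflection`. The §18 margin constant is then
`C₂₃₂ = 𝔅(𝔤,𝔤) = 𝔠₁ + 𝔠₂ + 2 Re 𝔠₃` with `𝔠₁ = 𝔅(g₁)` (§8), `𝔠₂ = 𝔅(g₂)` (§9; `𝔅` is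
reflection-invariant) and the cross slot `𝔠₃ ↔ P(g₁, R̃g₂)` (§§12–18). This file proves, for
arbitrary `H¹` profiles:

* `IsH1OnUnitInterval.refl` — `R̃` preserves `H¹` (the `L²` bound of the derivative companion by the
  measure-preserving map `y ↦ 1 − y` of `(0,1]`; the fundamental-theorem identity by splitting
  `∫₀¹ g′`);
* `IsH1OnUnitInterval.add_refl` — the glued profile is `H¹`;
* `mainTermForm_add_refl` — **`𝔅(g₁ + R̃g₂) = 𝔅(g₁) + 𝔅(g₂) + 2 Re P(g₁, R̃g₂)`** (polarisation
  `mainTermForm_add_smul` at `t = 1` + `mainTermForm_refl`);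
* `blocks_add_cross_nonneg` — `0 ≤ 𝔅(g₁) + 𝔅(g₂) + 2 Re P(g₁, R̃g₂)` (no negative direction, in
  block form); `polar_add_refl_left` — `P(g₁ + R̃g₂, f) = P(g₁,f) + P(R̃g₂,f)` (`𝔡 + 𝔡′`);
  `norm_sq_dsum_le_blocks`, `not_blocks_lt_norm_sq_dsum` — the Cauchy–Schwarz wall in BLOCK form:
  `|P(g₁,f) + P(R̃g₂,f)|² ≤ (𝔅(g₁) + 𝔅(g₂) + 2 Re P(g₁,R̃g₂))·𝔅(f)`, i.e. the shape into which the
  cell's dictionary identities (K-S1: `𝔠₁, 𝔠₂, C₂₃₃` blocks; K-S2: `𝔠₃ = P(g₁,R̃g₂)`; K-S3: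
  `𝔡 = P(g₁,f)`, `𝔡′ = P(R̃g₂,f)`) plug to give the verdict theorem of `RepairStructuralBarrier`.

Design-specific instances (the ϰ-profiles of (2.23)–(2.25), `gluedProfile θ ι`) are added once the
pair-block dictionary file types the ϰ-profile. Pure calculus; no new `Prop` facts.
-/

noncomputable section

open MeasureTheory Set intervalIntegral
open scoped Real ComplexConjugate

namespace Literature.NumberTheory.LFunctions.Zhang2022

variable {g g' a a' b b' f f' : ℝ → ℂ}

/-- `∫ₐᵇ conj f = conj ∫ₐᵇ f` for interval integrals. [folklore] -/
private theorem intervalIntegral_conj' (h : ℝ → ℂ) (x y : ℝ) :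
    ∫ t in x..y, conj (h t) = conj (∫ t in x..y, h t) := by
  simp only [intervalIntegral, integral_conj, map_sub]

/-- The map `y ↦ 1 − y` preserves Lebesgue measure restricted to `(0,1]` (its preimage of `(0,1]`
is `[0,1)`, which carries the same restricted measure). [folklore] -/
private theorem measurePreserving_one_sub_Ioc :
    MeasurePreserving (fun y : ℝ => 1 - y) (volume.restrict (Ioc (0:ℝ) 1))
      (volume.restrict (Ioc (0:ℝ) 1)) := by
  have h := (Measure.measurePreserving_sub_left (volume : Measure ℝ) (1:ℝ)).restrict_preimage
    (measurableSet_Ioc (a := (0:ℝ)) (b := 1))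
  have hpre : (fun y : ℝ => 1 - y) ⁻¹' Ioc (0:ℝ) 1 = Ico 0 1 := by
    ext y
    simp only [mem_preimage, mem_Ioc, mem_Ico]
    constructor <;> rintro ⟨h1, h2⟩ <;> constructor <;> linarith
  rw [hpre, restrict_Ico_eq_restrict_Ioc] at h
  exact h

/-- **`R̃` preserves `H¹`**: if `g ∈ H¹(0,1)` with derivative companion `g′`, then
`R̃g ∈ H¹(0,1)` with companion `y ↦ −conj g′(1−y)`. [cite: Zhang2022LandauSiegel, §12 (12.6)–(12.8)] -/
theorem IsH1OnUnitInterval.refl (hg : IsH1OnUnitInterval g g') :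
    IsH1OnUnitInterval (reflProfile g) (reflDeriv g') where
  memLp := by
    have h1 : MemLp (g' ∘ fun y : ℝ => 1 - y) 2 (volume.restrict (Ioc (0:ℝ) 1)) :=
      hg.memLp.comp_measurePreserving measurePreserving_one_sub_Ioc
    have h2 : MemLp (fun y => conj (g' (1 - y))) 2 (volume.restrict (Ioc (0:ℝ) 1)) :=
      (Complex.conjCLE.toContinuousLinearMap).comp_memLp' h1
    exact h2.neg
  eq_add_integral := fun y hy => by
    have hint : IntervalIntegrable g' volume 0 1 := hg.intervalIntegrable
    have hy1 : 1 - y ∈ Icc (0:ℝ) 1 := ⟨by linarith [hy.2], by linarith [hy.1]⟩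
    have e1 := hg.eq_add_integral 1 ⟨zero_le_one, le_rfl⟩
    have ey := hg.eq_add_integral (1 - y) hy1
    -- ∫₀ʸ R̃g′ = −conj ∫_{1−y}^1 g′
    have hI : ∫ t in (0:ℝ)..y, reflDeriv g' t = -conj (∫ t in (1 - y)..1, g' t) := by
      unfold reflDeriv
      rw [intervalIntegral.integral_neg, intervalIntegral_conj',
        intervalIntegral.integral_comp_sub_left (fun t => g' t) 1]
      simp
    have hsplit : ∫ t in (1 - y)..1, g' t = (∫ t in (0:ℝ)..1, g' t) - ∫ t in (0:ℝ)..(1 - y), g' t := by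
      have i1 : IntervalIntegrable g' volume 0 (1 - y) := hint.mono_set (by
        rw [uIcc_of_le zero_le_one, uIcc_of_le hy1.1]; exact Icc_subset_Icc_right hy1.2)
      have i2 : IntervalIntegrable g' volume (1 - y) 1 := hint.mono_set (by
        rw [uIcc_of_le zero_le_one, uIcc_of_le hy1.2]; exact Icc_subset_Icc_left hy1.1)
      rw [← intervalIntegral.integral_add_adjacent_intervals i1 i2]
      ring
    rw [hI, hsplit, reflProfile_zero]
    unfold reflProfile
    have : (∫ t in (0:ℝ)..1, g' t) - ∫ t in (0:ℝ)..(1 - y), g' t = g 1 - g (1 - y) := by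
      rw [e1, ey]; ring
    rw [this, map_sub]
    ring

/-! ### The glued profile and the block expansion of `𝔅` -/

/-- The glued profile `g₁ + R̃g₂` of two `H¹` halves is `H¹`. [cite: Zhang2022LandauSiegel, §2 (2.27); §12 (12.6)–(12.8)] -/
theorem IsH1OnUnitInterval.add_refl (ha : IsH1OnUnitInterval a a') (hb : IsH1OnUnitInterval b b') :
    IsH1OnUnitInterval (fun y => a y + reflProfile b y) (fun y => a' y + reflDeriv b' y) := by
  have h := ha.add_smul hb.refl 1
  simpa only [one_mul] using h

/-- **Block expansion of the glued form**: `𝔅(g₁ + R̃g₂) = 𝔅(g₁) + 𝔅(g₂) + 2 Re P(g₁, R̃g₂)` —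
the dictionary shape of `C₂₃₂ = 𝔠₁ + 𝔠₂ + 2 Re 𝔠₃` ((8.2), §18): the `𝔠₁`-block is the form of the
`H₁`-profile, the `𝔠₂`-block the form of the UNREFLECTED `H₂`-profile (`mainTermForm_refl`), and the
cross slot is the polar value `P(g₁, R̃g₂)`. [cite: Zhang2022LandauSiegel, §8 (8.2); §18 (18.1)] -/
theorem mainTermForm_add_refl (ha : IsH1OnUnitInterval a a') (hb : IsH1OnUnitInterval b b') :
    mainTermForm (fun y => a y + reflProfile b y) (fun y => a' y + reflDeriv b' y)
      = mainTermForm a a' + mainTermForm b b'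
        + 2 * (mainTermFormPolar a a' (reflProfile b) (reflDeriv b')).re := by
  have h := mainTermForm_add_smul ha hb.refl 1
  simp only [one_mul, map_one, norm_one, one_pow] at h
  rw [h, mainTermForm_refl hb.continuousOn b']
  ring

/-- **No negative direction (block form)**: `0 ≤ 𝔅(g₁) + 𝔅(g₂) + 2 Re P(g₁, R̃g₂)` for all `H¹` halves
— in the dictionary, `𝔠₁ + 𝔠₂ + 2 Re 𝔠₃ ≥ 0` at every design (T-zero impossible).
[cite: Zhang2022LandauSiegel, §2 Lemma 2.3, (2.32)] -/
theorem blocks_add_cross_nonneg (ha : IsH1OnUnitInterval a a') (hb : IsH1OnUnitInterval b b') :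
    0 ≤ mainTermForm a a' + mainTermForm b b'
      + 2 * (mainTermFormPolar a a' (reflProfile b) (reflDeriv b')).re := by
  rw [← mainTermForm_add_refl ha hb]
  exact mainTermForm_nonneg_of_isH1 (ha.add_refl hb)

/-- The cross mean splits over the glued profile: `P(g₁ + R̃g₂, f) = P(g₁, f) + P(R̃g₂, f)` — the
profile image of `Ξ₁* = Σ𝔠*(H₁J̄₁ + H̄₂J₂)ω` ((2.17)): `𝔡` from `H₁J̄₁`, `𝔡′` from the reflected
`H₂`-half. [cite: Zhang2022LandauSiegel, §2 (2.17)–(2.18); §10 (10.17)] -/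
theorem polar_add_refl_left (ha : IsH1OnUnitInterval a a') (hb : IsH1OnUnitInterval b b')
    (hf : IsH1OnUnitInterval f f') :
    mainTermFormPolar (fun y => a y + reflProfile b y) (fun y => a' y + reflDeriv b' y) f f'
      = mainTermFormPolar a a' f f' + mainTermFormPolar (reflProfile b) (reflDeriv b') f f' := by
  have h := mainTermFormPolar_add_smul_fst ha hb.refl hf 1
  simpa only [one_mul] using h

/-- **Cauchy–Schwarz wall in block form.** For `H¹` halves `g₁, g₂` and an `H¹` probe `f`, with
`𝔠₁ := 𝔅(g₁)`, `𝔠₂ := 𝔅(g₂)`, `𝔠₃ := P(g₁, R̃g₂)`, `c_J := 𝔅(f)`, `𝔡 := P(g₁, f)`,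
`𝔡′ := P(R̃g₂, f)`: `|𝔡 + 𝔡′|² ≤ (𝔠₁ + 𝔠₂ + 2 Re 𝔠₃)·c_J` — so the main-order closing inequality
`C₂₃₂·C₂₃₃ < |𝔡′+𝔡|²` of the §2 endgame is unattainable by block values of this provenance.
[cite: Zhang2022LandauSiegel, §2 (2.18), Props. 2.4–2.6, (2.32)–(2.33)] -/
theorem norm_sq_dsum_le_blocks (ha : IsH1OnUnitInterval a a') (hb : IsH1OnUnitInterval b b')
    (hf : IsH1OnUnitInterval f f') :
    ‖mainTermFormPolar a a' f f' + mainTermFormPolar (reflProfile b) (reflDeriv b') f f'‖ ^ 2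
      ≤ (mainTermForm a a' + mainTermForm b b'
          + 2 * (mainTermFormPolar a a' (reflProfile b) (reflDeriv b')).re) * mainTermForm f f' := by
  rw [← polar_add_refl_left ha hb hf, ← mainTermForm_add_refl ha hb]
  exact norm_sq_mainTermFormPolar_le (ha.add_refl hb) hf

/-- The negated strict form consumed by the verdict statement
(`RepairStructuralBarrier.not_repairable_true_need_of_dictionary`).
[cite: Zhang2022LandauSiegel, §2 (2.18), Props. 2.4–2.6, (2.32)–(2.33)] -/
theorem not_blocks_lt_norm_sq_dsum (ha : IsH1OnUnitInterval a a') (hb : IsH1OnUnitInterval b b')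
    (hf : IsH1OnUnitInterval f f') :
    ¬ ((mainTermForm a a' + mainTermForm b b'
          + 2 * (mainTermFormPolar a a' (reflProfile b) (reflDeriv b')).re) * mainTermForm f f'
        < ‖mainTermFormPolar a a' f f' + mainTermFormPolar (reflProfile b) (reflDeriv b') f f'‖ ^ 2) :=
  not_lt.2 (norm_sq_dsum_le_blocks ha hb hf)

end Literature.NumberTheory.LFunctions.Zhang2022
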